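import Summits.SmoothPoincare4.SmoothPoincare4.Theorems.CongruenceShadowsNilpotentApproximationStructure
import Summits.SmoothPoincare4.SmoothPoincare4.Theorems.CongruenceShadowsCongruenceApproximableStructure

/-!
# `NilpotentApproximation` (item stmt-SmoothPoincare4-14856, route CongruenceShadows) — structure II:
slot normalisation, the unipotent gate, and the logical position of the item

Continuation of `CongruenceShadowsNilpotentApproximationStructure.lean` (`--supports` the item).
Notation as there: `S m`, `N m`, `γ_{c+2} = (⊤ : Subgroup (S m)).lowerCentralSeries (c+1)`,
`A = Stab N₀`, `B = Stab N₁`, `C = Stab N₂ ⊆ Aut S`, `gate m = (A∩B)·C`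
(`Theorems/HeegaardHandlebodyCongruenceClosed/Negative/Gate.lean`).

* §3 `iff_gateForm` — slot normalisation (`normalise`): the item says exactly that for `β ∈ A` and
  `γ ∈ B` with `βN₂ = γN₂` such that the twisted triple `T_β = (N₀, N₁, βN₂)` is a `(3+3m; m+1)` group
  trisection of `{1}` with standard nilpotent shadows, `β ∈ (A∩B)·C`: the UNIPOTENT GATE
  `A ∩ B·C ∩ T ∩ NilSh ⊆ (A∩B)·C`, companion of the congruence gate
  (`CongruenceApproximable.shadowApproximation_iff_gateForm`, item 14855); `inGate_of_coherent` — on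
  that locus one COHERENT standardisation already puts `β` in the gate.
* §4 `nilShadows_of_iso`, `conclusion_of_iso` — sanity: every `α • N` satisfies hypotheses and conclusion
  (a refutation needs a homotopy-4-sphere trisection NOT isomorphic to `N` at its own genus).
* §5 `unipotentPair_iff_unstableGate` — logical position: given `WaldhausenPairs` (14592),
  `NilpotentShadowsStandard ∧ NilpotentApproximation` is EQUIVALENT to the unstable gate "every
  `(3+3m; m+1)` group trisection of `{1}` is `Iso` to `N`" (SPC4 ∧ balanced 4-d Waldhausen, genus by
  genus); `normalFormStablyTrivial_of` re-derives the route target from the pair (`ArtinGates.2`).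

No new definitions; `pairs_twisted` is imported from `Theorems/CongruenceShadowsCongruenceApproximableStructure.lean`
(item 14855, same import cone), the `map` algebra from Part I.
-/

-- the prescribed namespace `Summit.<P>.<Sub>.…` duplicates `SmoothPoincare4` (P = Sub)
set_option linter.dupNamespace false

noncomputable section

namespace Summit.SmoothPoincare4.SmoothPoincare4.Theorems.NilpotentApproximation

open Literature.Topology.FourManifolds Subgroup
open Summit.SmoothPoincare4.SmoothPoincare4.Theses.CongruenceShadows
open Summit.SmoothPoincare4.SmoothPoincare4.Theorems.HeegaardHandlebodyCongruenceClosed.Negative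
  (S N gate map_trans inGate_iff N_isGroupTrisection)
open Summit.SmoothPoincare4.SmoothPoincare4.Theorems.WaldhausenPairs.Negative (IsGroupTrisection.map_mulEquiv)
open Summit.SmoothPoincare4.SmoothPoincare4.Theorems.CongruenceApproximable (pairs_twisted)

/-! ## §3 Slot normalisation and the gate form (the unipotent gate) -/

/-- The nilpotent-shadow hypothesis is transported along automorphisms (`γ_{c+2}` characteristic). [folklore] -/
theorem nilShadows_map {m : ℕ} {K : TrisectionKernels (3 + 3 * m)}
    (hS : ∀ c : ℕ, ∃ ψ : S m ≃* S m, ∀ i : Fin 3,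
      (N m i ⊔ (⊤ : Subgroup (S m)).lowerCentralSeries (c + 1)).map ψ.toMonoidHom =
        K i ⊔ (⊤ : Subgroup (S m)).lowerCentralSeries (c + 1)) (e : S m ≃* S m) :
    ∀ c : ℕ, ∃ ψ : S m ≃* S m, ∀ i : Fin 3,
      (N m i ⊔ (⊤ : Subgroup (S m)).lowerCentralSeries (c + 1)).map ψ.toMonoidHom =
        (K i).map e.toMonoidHom ⊔ (⊤ : Subgroup (S m)).lowerCentralSeries (c + 1) := by
  intro c
  obtain ⟨ψ, hψ⟩ := hS c
  refine ⟨ψ.trans e, fun i => ?_⟩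
  rw [map_trans, hψ i, Subgroup.map_sup, map_lcs]

/-- **Normalisation.** A Waldhausen-normalised `K` with standard nilpotent shadows is `α • T_β` for a
remarking `α` of the standard pair and a twist `β ∈ A` with `βN₂ = γN₂`, `γ ∈ B`; the twisted triple
`T_β = α⁻¹ • K` is again a group trisection of `{1}` (transport) with standard nilpotent shadows. [folklore] -/
theorem normalise {m : ℕ} {K : TrisectionKernels (3 + 3 * m)}
    (hK : IsGroupTrisection (3 + 3 * m) (m + 1) (PUnit : Type) K)
    (hP : ∀ i j : Fin 3, i ≠ j → ∃ α : S m ≃* S m, (N m i).map α.toMonoidHom = K i ∧ (N m j).map α.toMonoidHom = K j)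
    (hS : ∀ c : ℕ, ∃ ψ : S m ≃* S m, ∀ i : Fin 3,
      (N m i ⊔ (⊤ : Subgroup (S m)).lowerCentralSeries (c + 1)).map ψ.toMonoidHom =
        K i ⊔ (⊤ : Subgroup (S m)).lowerCentralSeries (c + 1)) :
    ∃ α β γ : S m ≃* S m,
      (N m 0).map α.toMonoidHom = K 0 ∧ (N m 1).map α.toMonoidHom = K 1 ∧
      ((N m 2).map β.toMonoidHom).map α.toMonoidHom = K 2 ∧
      (N m 0).map β.toMonoidHom = N m 0 ∧ (N m 1).map γ.toMonoidHom = N m 1 ∧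
      (N m 2).map γ.toMonoidHom = (N m 2).map β.toMonoidHom ∧
      IsGroupTrisection (3 + 3 * m) (m + 1) (PUnit : Type)
        (![N m 0, N m 1, (N m 2).map β.toMonoidHom] : TrisectionKernels (3 + 3 * m)) ∧
      (∀ c : ℕ, ∃ ψ : S m ≃* S m, ∀ i : Fin 3,
        (N m i ⊔ (⊤ : Subgroup (S m)).lowerCentralSeries (c + 1)).map ψ.toMonoidHom =
          (![N m 0, N m 1, (N m 2).map β.toMonoidHom] : TrisectionKernels (3 + 3 * m)) i ⊔
            (⊤ : Subgroup (S m)).lowerCentralSeries (c + 1)) := by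
  obtain ⟨α, hα0, hα1⟩ := hP 0 1 (by decide)
  obtain ⟨β', hβ0, hβ2⟩ := hP 0 2 (by decide)
  obtain ⟨γ', hγ1, hγ2⟩ := hP 1 2 (by decide)
  have hK' : (![N m 0, N m 1, (N m 2).map (β'.trans α.symm).toMonoidHom] : TrisectionKernels (3 + 3 * m)) =
      fun i => (K i).map α.symm.toMonoidHom := by
    funext i
    fin_cases i
    · exact (map_symm_of_map_eq hα0).symm
    · exact (map_symm_of_map_eq hα1).symm
    · show (N m 2).map (β'.trans α.symm).toMonoidHom = (K 2).map α.symm.toMonoidHom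
      rw [map_trans, hβ2]
  refine ⟨α, β'.trans α.symm, γ'.trans α.symm, hα0, hα1, ?_, ?_, ?_, ?_, ?_, ?_⟩
  · have e : (β'.trans α.symm).trans α = β' := by
      ext s
      simp
    rw [← map_trans, e, hβ2]
  · rw [map_trans, hβ0, map_symm_of_map_eq hα0]
  · rw [map_trans, hγ1, map_symm_of_map_eq hα1]
  · rw [map_trans, hγ2, map_trans, hβ2]
  · rw [hK']
    exact IsGroupTrisection.map_mulEquiv hK α.symm
  · rw [hK']
    exact nilShadows_map hS α.symm

/-- **Gate form of the item (the unipotent gate).** `NilpotentApproximation` says exactly: for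
`β ∈ A = Stab N₀` and `γ ∈ B = Stab N₁` with `βN₂ = γN₂` such that `T_β = (N₀, N₁, βN₂)` is a
`(3+3m; m+1)` group trisection of the trivial group all of whose NILPOTENT shadows are standard,
`β ∈ (A∩B)·C` — the inclusion `A ∩ B·C ∩ T ∩ NilSh ⊆ (A∩B)·C`. [folklore] -/
theorem iff_gateForm :
    NilpotentApproximation ↔ ∀ (m : ℕ) (β γ : S m ≃* S m), (N m 0).map β.toMonoidHom = N m 0 →
      (N m 1).map γ.toMonoidHom = N m 1 → (N m 2).map γ.toMonoidHom = (N m 2).map β.toMonoidHom →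
      IsGroupTrisection (3 + 3 * m) (m + 1) (PUnit : Type)
        (![N m 0, N m 1, (N m 2).map β.toMonoidHom] : TrisectionKernels (3 + 3 * m)) →
      (∀ c : ℕ, ∃ ψ : S m ≃* S m, ∀ i : Fin 3,
        (N m i ⊔ (⊤ : Subgroup (S m)).lowerCentralSeries (c + 1)).map ψ.toMonoidHom =
          (![N m 0, N m 1, (N m 2).map β.toMonoidHom] : TrisectionKernels (3 + 3 * m)) i ⊔
            (⊤ : Subgroup (S m)).lowerCentralSeries (c + 1)) →
      β ∈ gate m := by
  constructor
  · intro h m β γ hβ0 hγ1 hγ2 hT hSh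
    obtain ⟨x, hx⟩ := h m (![N m 0, N m 1, (N m 2).map β.toMonoidHom] : TrisectionKernels (3 + 3 * m)) hT
      (pairs_twisted hβ0 hγ1 hγ2) hSh
    exact (inGate_iff m β).2 ⟨x, hx 0, hx 1, hx 2⟩
  · intro h m K hK hP hS
    obtain ⟨α, β, γ, h0, h1, h2, hβ0, hγ1, hγ2, hT, hSh⟩ := normalise hK hP hS
    obtain ⟨x, hx0, hx1, hx2⟩ := (inGate_iff m β).1 (h m β γ hβ0 hγ1 hγ2 hT hSh)
    refine ⟨x.trans α, fun i => ?_⟩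
    fin_cases i
    · show (N m 0).map (x.trans α).toMonoidHom = K 0
      rw [map_trans, hx0, h0]
    · show (N m 1).map (x.trans α).toMonoidHom = K 1
      rw [map_trans, hx1, h1]
    · show (N m 2).map (x.trans α).toMonoidHom = K 2
      rw [map_trans, hx2, h2]

/-- **Gate form, coherent version**: on the same locus, if ONE `ψ` standardises `T_β` at every
nilpotent level then already `β ∈ (A∩B)·C` — no appeal to the item. [folklore] -/
theorem inGate_of_coherent {m : ℕ} {β : S m ≃* S m}
    (hT : IsGroupTrisection (3 + 3 * m) (m + 1) (PUnit : Type)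
      (![N m 0, N m 1, (N m 2).map β.toMonoidHom] : TrisectionKernels (3 + 3 * m)))
    {ψ : S m ≃* S m}
    (hψ : ∀ (c : ℕ) (i : Fin 3), (N m i ⊔ (⊤ : Subgroup (S m)).lowerCentralSeries (c + 1)).map ψ.toMonoidHom =
      (![N m 0, N m 1, (N m 2).map β.toMonoidHom] : TrisectionKernels (3 + 3 * m)) i ⊔
        (⊤ : Subgroup (S m)).lowerCentralSeries (c + 1)) :
    β ∈ gate m := by
  have hx := iso_of_coherent m _ hT ψ hψ
  exact (inGate_iff m β).2 ⟨ψ, hx 0, hx 1, hx 2⟩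

/-! ## §4 Sanity: the standard models -/

/-- An isomorphic copy `α • N` of the standard triple has standard nilpotent shadows at every level
(witness `ψ_c := α`); in particular the hypotheses of the item are satisfiable with a non-trivial
conclusion. [folklore] -/
theorem nilShadows_of_iso {m : ℕ} {K : TrisectionKernels (3 + 3 * m)} {α : S m ≃* S m}
    (hα : ∀ i, (N m i).map α.toMonoidHom = K i) :
    ∀ c : ℕ, ∃ ψ : S m ≃* S m, ∀ i : Fin 3,
      (N m i ⊔ (⊤ : Subgroup (S m)).lowerCentralSeries (c + 1)).map ψ.toMonoidHom =
        K i ⊔ (⊤ : Subgroup (S m)).lowerCentralSeries (c + 1) :=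
  fun c => ⟨α, fun i => by rw [Subgroup.map_sup, hα i, map_lcs]⟩

/-- The conclusion of the item holds at every isomorphic copy of the standard triple (so the item is not
refutable inside the `Aut S`-orbit of `N`; a refutation needs a trisection of a homotopy 4-sphere that is
NOT isomorphic to `N` at its own genus). [folklore] -/
theorem conclusion_of_iso {m : ℕ} {K : TrisectionKernels (3 + 3 * m)} {α : S m ≃* S m}
    (hα : ∀ i, (N m i).map α.toMonoidHom = K i) : TrisectionKernels.Iso (N m) K :=
  ⟨α, hα⟩

/-! ## §5 Logical position in the route: with the blind half, the item is the unstable gate -/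

/-- **BLIND ∧ APPROXIMATION = the unstable gate.** `NilpotentShadowsStandard` (stmt-SmoothPoincare4-14594)
and the item together say that every Waldhausen-normalised `(3+3m; m+1)` group trisection of the
trivial group is isomorphic to the standard one AT ITS OWN GENUS. [folklore] -/
theorem unstableGate_of (hB : NilpotentShadowsStandard) (hA : NilpotentApproximation) :
    ∀ (m : ℕ) (K : TrisectionKernels (3 + 3 * m)), IsGroupTrisection (3 + 3 * m) (m + 1) (PUnit : Type) K →
      (∀ i j : Fin 3, i ≠ j → ∃ α : S m ≃* S m, (N m i).map α.toMonoidHom = K i ∧ (N m j).map α.toMonoidHom = K j) →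
      TrisectionKernels.Iso (N m) K :=
  fun m K hK hP => hA m K hK hP (hB m K hK)

/-- Conversely the unstable gate implies the item outright (the shadow hypothesis is not even used) … [folklore] -/
theorem of_unstableGate
    (hU : ∀ (m : ℕ) (K : TrisectionKernels (3 + 3 * m)), IsGroupTrisection (3 + 3 * m) (m + 1) (PUnit : Type) K →
      (∀ i j : Fin 3, i ≠ j → ∃ α : S m ≃* S m, (N m i).map α.toMonoidHom = K i ∧ (N m j).map α.toMonoidHom = K j) →
      TrisectionKernels.Iso (N m) K) :
    NilpotentApproximation :=
  fun m K hK hP _ => hU m K hK hP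

/-- … and, given `WaldhausenPairs` (stmt-SmoothPoincare4-14592, a published theorem), also the blind
half: an isomorphic copy of `N` has standard nilpotent shadows (`nilShadows_of_iso`). [folklore] -/
theorem nilpotentShadowsStandard_of_unstableGate (hW : WaldhausenPairs)
    (hU : ∀ (m : ℕ) (K : TrisectionKernels (3 + 3 * m)), IsGroupTrisection (3 + 3 * m) (m + 1) (PUnit : Type) K →
      (∀ i j : Fin 3, i ≠ j → ∃ α : S m ≃* S m, (N m i).map α.toMonoidHom = K i ∧ (N m j).map α.toMonoidHom = K j) →
      TrisectionKernels.Iso (N m) K) :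
    NilpotentShadowsStandard := by
  intro m K hK c
  obtain ⟨α, hα⟩ := hU m K hK (hW m K hK)
  exact nilShadows_of_iso hα c

/-- **Logical position.** Given `WaldhausenPairs`, the unipotent pair of the route —
`NilpotentShadowsStandard ∧ NilpotentApproximation` — is EQUIVALENT to the unstable gate "every
`(3+3m; m+1)` group trisection of the trivial group is isomorphic to the standard `S⁴` triple of the
same genus" (balanced 4-dimensional Waldhausen for homotopy 4-spheres ∧ SPC4, genus by genus). So the
two items split an SPC4-hard statement into a blind half and an approximation half, and neither half
is implied by the other formally. [folklore] -/
theorem unipotentPair_iff_unstableGate (hW : WaldhausenPairs) :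
    (NilpotentShadowsStandard ∧ NilpotentApproximation) ↔
      ∀ (m : ℕ) (K : TrisectionKernels (3 + 3 * m)), IsGroupTrisection (3 + 3 * m) (m + 1) (PUnit : Type) K →
        TrisectionKernels.Iso (N m) K := by
  constructor
  · rintro ⟨hB, hA⟩ m K hK
    exact unstableGate_of hB hA m K hK (hW m K hK)
  · intro hU
    exact ⟨nilpotentShadowsStandard_of_unstableGate hW fun m K hK _ => hU m K hK,
      of_unstableGate fun m K hK _ => hU m K hK⟩

/-- In particular the unipotent pair proves the route target `NormalFormStablyTrivial` (the second
conjunct of `ArtinGates`, stmt-SmoothPoincare4-14857, here re-derived: `IsStablyTrivial` with no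
stabilisation, via the inverse of the isomorphism). [folklore] -/
theorem normalFormStablyTrivial_of (hB : NilpotentShadowsStandard) (hA : NilpotentApproximation) :
    NormalFormStablyTrivial := by
  intro m K hK hP
  obtain ⟨α, hα⟩ := unstableGate_of hB hA m K hK hP
  refine ⟨0, m, rfl, α.symm, fun i => ?_⟩
  show (K i).map α.symm.toMonoidHom = N m i
  exact map_symm_of_map_eq (hα i)

end Summit.SmoothPoincare4.SmoothPoincare4.Theorems.NilpotentApproximation

end
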